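import Literature.MathematicalPhysics.QuantumFieldTheory.CurvatureGaussianField
import HarnessLib

/-!
# Stub `stub_exactShiftInvariance` of line `Sketch` (crux `stmt-QuantumFields-8760`)

Route `EquipartitionCriticality` of `YangMills`, crux item `stmt-QuantumFields-8760`
(`Summit.QuantumFields.YangMills.Theses.EquipartitionCriticality.EquipartitionPinsProbe`), line
`Sketch`.

What is proved: the rigidity functional of the lattice Maxwell Gaussian field on `ℤ⁴`,
`Ψ(h) = exp(Q_S(h)/2) · (E_τ cos⟨Y,h⟩_S, E_τ sin⟨Y,h⟩_S)` with
`Q_S(g) = ∑_{p,q ∈ S} ∑_a g_p^a g_q^a T(p,q)` (`T = curvatureTwoPoint`) and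
`⟨Y,g⟩_S = ∑_{p ∈ S} ∑_a g_p^a Y_p^a`, is invariant under exact shifts `h ↦ h + dα`
(`dα = plaquetteCurl α`, `α` supported in a finite edge set `E`, `dα` supported in `S`), given
* (R1) the Stein flow `E_τ cos⟨Y,h + dα⟩_S = exp(-A - B/2) E_τ cos⟨Y,h⟩_S` (and with `sin`),
  `A = ⟨dα,h⟩_S`, `B = ‖dα‖²_S`, and
* (R2) the reproduction of exact forms by the kernel, `∑_{q ∈ S} (dα)_q T(q,p) = (dα)_p`,
both taken as hypotheses (they are the landed stubs `stub_steinFlow`, `stub_kernelFixesExact`).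

Proof: (R2) at each colour `a` and the symmetry `T(p,q) = T(q,p)` give the algebraic identity
`Q_S(h + dα) = Q_S(h) + 2A + B` (`ExactShiftInvariance.sum_shift_quadratic`), and
`exp((Q + 2A + B)/2) · exp(-A - B/2) = exp(Q/2)` (`ExactShiftInvariance.exp_mul_eq`).
-/

noncomputable section

open MeasureTheory

open Literature.MathematicalPhysics.QuantumFieldTheory Literature.MathematicalPhysics.QuantumLattice

namespace Summit.QuantumFields.YangMills.Theorems.EquipartitionPinsProbe

namespace ExactShiftInvariance

/-- **Quadratic functional under a reproduced shift.** If the kernel `T` is symmetric and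
reproduces `c` colourwise on `S` (`∑_{q ∈ S} c_q^a T(q,p) = c_p^a`), then
`Q_S(h + c) = Q_S(h) + 2 ⟨c,h⟩_S + ‖c‖²_S` for the quadratic functional
`Q_S(g) = ∑_{p,q ∈ S} ∑_a g_p^a g_q^a T(p,q)`. -/
theorem sum_shift_quadratic {P : Type*} {D : ℕ} (S : Finset P) (h c : P → Fin D → ℝ)
    (T : P → P → ℝ) (hT : ∀ p q, T p q = T q p)
    (hK : ∀ (a : Fin D) (p : P), ∑ q ∈ S, c q a * T q p = c p a) :
    ∑ p ∈ S, ∑ q ∈ S, ∑ a : Fin D, (h p a + c p a) * (h q a + c q a) * T p q =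
      ∑ p ∈ S, ∑ q ∈ S, ∑ a : Fin D, h p a * h q a * T p q +
        2 * (∑ p ∈ S, ∑ a : Fin D, c p a * h p a) + ∑ p ∈ S, ∑ a : Fin D, c p a ^ 2 := by
  have h1 : ∑ p ∈ S, ∑ q ∈ S, ∑ a : Fin D, h p a * c q a * T p q =
      ∑ p ∈ S, ∑ a : Fin D, c p a * h p a := by
    refine Finset.sum_congr rfl fun p _ => ?_
    rw [Finset.sum_comm]
    refine Finset.sum_congr rfl fun a _ => ?_
    have : ∑ q ∈ S, h p a * c q a * T p q = h p a * ∑ q ∈ S, c q a * T q p := by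
      rw [Finset.mul_sum]
      refine Finset.sum_congr rfl fun q _ => ?_
      rw [hT p q]
      ring
    rw [this, hK a p, mul_comm]
  have h2 : ∑ p ∈ S, ∑ q ∈ S, ∑ a : Fin D, c p a * h q a * T p q =
      ∑ p ∈ S, ∑ a : Fin D, c p a * h p a := by
    rw [Finset.sum_comm]
    refine Finset.sum_congr rfl fun q _ => ?_
    rw [Finset.sum_comm]
    refine Finset.sum_congr rfl fun a _ => ?_
    have : ∑ p ∈ S, c p a * h q a * T p q = h q a * ∑ p ∈ S, c p a * T p q := by
      rw [Finset.mul_sum]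
      refine Finset.sum_congr rfl fun p _ => ?_
      ring
    rw [this, hK a q, mul_comm]
  have h3 : ∑ p ∈ S, ∑ q ∈ S, ∑ a : Fin D, c p a * c q a * T p q =
      ∑ p ∈ S, ∑ a : Fin D, c p a ^ 2 := by
    rw [Finset.sum_comm]
    refine Finset.sum_congr rfl fun q _ => ?_
    rw [Finset.sum_comm]
    refine Finset.sum_congr rfl fun a _ => ?_
    have : ∑ p ∈ S, c p a * c q a * T p q = c q a * ∑ p ∈ S, c p a * T p q := by
      rw [Finset.mul_sum]
      refine Finset.sum_congr rfl fun p _ => ?_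
      ring
    rw [this, hK a q, sq]
  have hexp : ∀ (p q : P) (a : Fin D), (h p a + c p a) * (h q a + c q a) * T p q =
      h p a * h q a * T p q +
        (h p a * c q a * T p q + c p a * h q a * T p q + c p a * c q a * T p q) := by
    intros
    ring
  simp only [hexp, Finset.sum_add_distrib]
  rw [h1, h2, h3]
  ring

/-- **Exponential bookkeeping.** Under the hypotheses of `sum_shift_quadratic`, if
`I = exp(-⟨c,h⟩_S - ‖c‖²_S/2) J` then `exp(Q_S(h + c)/2) I = exp(Q_S(h)/2) J`. -/
theorem exp_mul_eq {P : Type*} {D : ℕ} (S : Finset P) (h c : P → Fin D → ℝ)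
    (T : P → P → ℝ) (hT : ∀ p q, T p q = T q p)
    (hK : ∀ (a : Fin D) (p : P), ∑ q ∈ S, c q a * T q p = c p a) (I J : ℝ)
    (hIJ : I = Real.exp (-(∑ p ∈ S, ∑ a : Fin D, c p a * h p a) -
      (∑ p ∈ S, ∑ a : Fin D, c p a ^ 2) / 2) * J) :
    Real.exp ((∑ p ∈ S, ∑ q ∈ S, ∑ a : Fin D,
        (h p a + c p a) * (h q a + c q a) * T p q) / 2) * I =
      Real.exp ((∑ p ∈ S, ∑ q ∈ S, ∑ a : Fin D, h p a * h q a * T p q) / 2) * J := by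
  subst hIJ
  rw [sum_shift_quadratic S h c T hT hK, ← mul_assoc, ← Real.exp_add]
  congr 2
  ring

end ExactShiftInvariance

/-- STUB R3 — **invariance of the rigidity functional under exact shifts**: for a probability
measure `τ` on `ℝ^D`-valued `2`-cochains of `ℤ⁴` with integrable coordinates satisfying the
trigonometric Stein identity (T3) along exact directions, the functional
`Ψ(h) = exp(Q_S(h)/2) · (E_τ cos⟨Y,h⟩_S, E_τ sin⟨Y,h⟩_S)` satisfies `Ψ(h + dα) = Ψ(h)` for every
`1`-cochain `α` supported in a finite edge set `E` with `dα = plaquetteCurl α` supported in `S`;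
here (R1) = the Stein flow (`stub_steinFlow`) and (R2) = the reproduction of exact forms by the
kernel (`stub_kernelFixesExact`) are hypotheses. Proof: (R1) gives the factor `exp(-A - B/2)`,
(R2) colourwise with `curvatureTwoPoint_comm` gives `Q_S(h + dα) = Q_S(h) + 2A + B`
(`ExactShiftInvariance.sum_shift_quadratic`), and the exponentials cancel
(`ExactShiftInvariance.exp_mul_eq`). -/
theorem stub_exactShiftInvariance :
    (∀ (D : ℕ) (τ : Measure (ZdPlaquette 4 → Fin D → ℝ)), IsProbabilityMeasure τ →
      (∀ (p : ZdPlaquette 4) (a : Fin D),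
        Integrable (fun Y : ZdPlaquette 4 → Fin D → ℝ => Y p a) τ) →
      (∀ (S : Finset (ZdPlaquette 4)) (E : Finset (ZdEdge 4)) (h : ZdPlaquette 4 → Fin D → ℝ)
          (α : ZdEdge 4 → Fin D → ℝ),
        (∀ e, e ∉ E → α e = 0) →
        (∀ p, p ∉ S → ∀ a : Fin D, plaquetteCurl (fun e => α e a) p = 0) →
        (∫ Y, Real.cos (∑ p ∈ S, ∑ a : Fin D, h p a * Y p a) *
            (∑ p ∈ S, ∑ a : Fin D, plaquetteCurl (fun e => α e a) p * Y p a) ∂τ =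
          -(∑ p ∈ S, ∑ a : Fin D, plaquetteCurl (fun e => α e a) p * h p a) *
            ∫ Y, Real.sin (∑ p ∈ S, ∑ a : Fin D, h p a * Y p a) ∂τ) ∧
        (∫ Y, Real.sin (∑ p ∈ S, ∑ a : Fin D, h p a * Y p a) *
            (∑ p ∈ S, ∑ a : Fin D, plaquetteCurl (fun e => α e a) p * Y p a) ∂τ =
          (∑ p ∈ S, ∑ a : Fin D, plaquetteCurl (fun e => α e a) p * h p a) *
            ∫ Y, Real.cos (∑ p ∈ S, ∑ a : Fin D, h p a * Y p a) ∂τ)) →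
      ∀ (S : Finset (ZdPlaquette 4)) (E : Finset (ZdEdge 4)) (h : ZdPlaquette 4 → Fin D → ℝ)
          (α : ZdEdge 4 → Fin D → ℝ),
        (∀ e, e ∉ E → α e = 0) →
        (∀ p, p ∉ S → ∀ a : Fin D, plaquetteCurl (fun e => α e a) p = 0) →
        (∫ Y, Real.cos (∑ p ∈ S, ∑ a : Fin D,
            (h p a + plaquetteCurl (fun e => α e a) p) * Y p a) ∂τ =
          Real.exp (-(∑ p ∈ S, ∑ a : Fin D, plaquetteCurl (fun e => α e a) p * h p a) -
              (∑ p ∈ S, ∑ a : Fin D, (plaquetteCurl (fun e => α e a) p) ^ 2) / 2) *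
            ∫ Y, Real.cos (∑ p ∈ S, ∑ a : Fin D, h p a * Y p a) ∂τ) ∧
        (∫ Y, Real.sin (∑ p ∈ S, ∑ a : Fin D,
            (h p a + plaquetteCurl (fun e => α e a) p) * Y p a) ∂τ =
          Real.exp (-(∑ p ∈ S, ∑ a : Fin D, plaquetteCurl (fun e => α e a) p * h p a) -
              (∑ p ∈ S, ∑ a : Fin D, (plaquetteCurl (fun e => α e a) p) ^ 2) / 2) *
            ∫ Y, Real.sin (∑ p ∈ S, ∑ a : Fin D, h p a * Y p a) ∂τ)) →
    (∀ (S : Finset (ZdPlaquette 4)) (E : Finset (ZdEdge 4)) (α : ZdEdge 4 → ℝ),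
      (∀ e, e ∉ E → α e = 0) → (∀ p, p ∉ S → plaquetteCurl α p = 0) →
      ∀ p : ZdPlaquette 4,
        ∑ q ∈ S, plaquetteCurl α q * curvatureTwoPoint q p = plaquetteCurl α p) →
    ∀ (D : ℕ) (τ : Measure (ZdPlaquette 4 → Fin D → ℝ)), IsProbabilityMeasure τ →
      (∀ (p : ZdPlaquette 4) (a : Fin D),
        Integrable (fun Y : ZdPlaquette 4 → Fin D → ℝ => Y p a) τ) →
      (∀ (S : Finset (ZdPlaquette 4)) (E : Finset (ZdEdge 4)) (h : ZdPlaquette 4 → Fin D → ℝ)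
          (α : ZdEdge 4 → Fin D → ℝ),
        (∀ e, e ∉ E → α e = 0) →
        (∀ p, p ∉ S → ∀ a : Fin D, plaquetteCurl (fun e => α e a) p = 0) →
        (∫ Y, Real.cos (∑ p ∈ S, ∑ a : Fin D, h p a * Y p a) *
            (∑ p ∈ S, ∑ a : Fin D, plaquetteCurl (fun e => α e a) p * Y p a) ∂τ =
          -(∑ p ∈ S, ∑ a : Fin D, plaquetteCurl (fun e => α e a) p * h p a) *
            ∫ Y, Real.sin (∑ p ∈ S, ∑ a : Fin D, h p a * Y p a) ∂τ) ∧
        (∫ Y, Real.sin (∑ p ∈ S, ∑ a : Fin D, h p a * Y p a) *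
            (∑ p ∈ S, ∑ a : Fin D, plaquetteCurl (fun e => α e a) p * Y p a) ∂τ =
          (∑ p ∈ S, ∑ a : Fin D, plaquetteCurl (fun e => α e a) p * h p a) *
            ∫ Y, Real.cos (∑ p ∈ S, ∑ a : Fin D, h p a * Y p a) ∂τ)) →
      ∀ (S : Finset (ZdPlaquette 4)) (E : Finset (ZdEdge 4)) (h : ZdPlaquette 4 → Fin D → ℝ)
          (α : ZdEdge 4 → Fin D → ℝ),
        (∀ e, e ∉ E → α e = 0) →
        (∀ p, p ∉ S → ∀ a : Fin D, plaquetteCurl (fun e => α e a) p = 0) →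
        (Real.exp ((∑ p ∈ S, ∑ q ∈ S, ∑ a : Fin D,
              (h p a + plaquetteCurl (fun e => α e a) p) *
                (h q a + plaquetteCurl (fun e => α e a) q) * curvatureTwoPoint p q) / 2) *
            ∫ Y, Real.cos (∑ p ∈ S, ∑ a : Fin D,
              (h p a + plaquetteCurl (fun e => α e a) p) * Y p a) ∂τ =
          Real.exp ((∑ p ∈ S, ∑ q ∈ S, ∑ a : Fin D, h p a * h q a * curvatureTwoPoint p q) / 2) *
            ∫ Y, Real.cos (∑ p ∈ S, ∑ a : Fin D, h p a * Y p a) ∂τ) ∧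
        (Real.exp ((∑ p ∈ S, ∑ q ∈ S, ∑ a : Fin D,
              (h p a + plaquetteCurl (fun e => α e a) p) *
                (h q a + plaquetteCurl (fun e => α e a) q) * curvatureTwoPoint p q) / 2) *
            ∫ Y, Real.sin (∑ p ∈ S, ∑ a : Fin D,
              (h p a + plaquetteCurl (fun e => α e a) p) * Y p a) ∂τ =
          Real.exp ((∑ p ∈ S, ∑ q ∈ S, ∑ a : Fin D, h p a * h q a * curvatureTwoPoint p q) / 2) *
            ∫ Y, Real.sin (∑ p ∈ S, ∑ a : Fin D, h p a * Y p a) ∂τ) := by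
  intro hR1 hR2 D τ hτ hint hT3 S E h α hαE hαS
  obtain ⟨hcos, hsin⟩ := hR1 D τ hτ hint hT3 S E h α hαE hαS
  have hK : ∀ (a : Fin D) (p : ZdPlaquette 4),
      ∑ q ∈ S, plaquetteCurl (fun e => α e a) q * curvatureTwoPoint q p =
        plaquetteCurl (fun e => α e a) p :=
    fun a => hR2 S E (fun e => α e a) (fun e he => by simp [hαE e he]) (fun p hp => hαS p hp a)
  exact ⟨ExactShiftInvariance.exp_mul_eq S h (fun p a => plaquetteCurl (fun e => α e a) p)
      curvatureTwoPoint curvatureTwoPoint_comm hK _ _ hcos,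
    ExactShiftInvariance.exp_mul_eq S h (fun p a => plaquetteCurl (fun e => α e a) p)
      curvatureTwoPoint curvatureTwoPoint_comm hK _ _ hsin⟩

end Summit.QuantumFields.YangMills.Theorems.EquipartitionPinsProbe

end
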